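import Summits.ResolutionOfSingularities.ResolutionOfSingularities.Theses.IndSmooth
import Summits.ResolutionOfSingularities.ResolutionOfSingularities.Theorems.IndSmoothSmoothToUniformizingValuativeJacobian
import Summits.ResolutionOfSingularities.ResolutionOfSingularities.Theorems.IndSmoothSmoothToUniformizingFlatOfRegularCentre
import HarnessLib

/-!
# Flat levels ⇔ regular models: line `birth` of crux `IndSmooth.SmoothToUniformizing` has no slack
# (stmt-ResolutionOfSingularities-16088, certificate `stub_flatLevelAt_iff_lurelAt`)

Route `ResolutionOfSingularities/IndSmooth`, crux #3 `SmoothToUniformizing` (the injectivity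
upgrade: ind-smoothness of all valuation rings of function fields over perfect fields of
characteristic `p` ⇒ relative local uniformization at `p`). The registered skeleton of line `birth`
(`Cruxes/SmoothToUniformizing/Lines/birth.lean`, sha `45a7756e…`) cuts the crux at Néron's
smoothness measure along the valuation:

* `stub_flatKaehlerLevel` : ind-smooth at `p` ⇒ FLAT LEVEL at `p` (every f.g. `R ⊆ O` lies in a f.g.
  `B ⊆ O` with `Frac B = K` and `O ⊗_B Ω[B⁄k]` flat over `O`);
* `stub_valuativeJacobian` : flat along `O` ⇒ regular at the centre (LANDED,
  `IndSmoothSmoothToUniformizingValuativeJacobian.lean`);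
* `stub_flatOfRegularCentre` : regular at the centre ⇒ flat along `O` (LANDED,
  `IndSmoothSmoothToUniformizingFlatOfRegularCentre.lean`).

This file records the consequence, kernel-checked: **at every `p`, "a flat level exists" and "a
model regular at the centre exists" are EQUIVALENT** (`stub_flatLevelAt_iff_lurelAt`, pointwise in
`(k, K, O, R)`: `hasFlatLevel_iff_hasModel`), hence **the statement of the load-bearing stub
`stub_flatKaehlerLevel` is equivalent to the crux `SmoothToUniformizing` itself**
(`flatKaehlerLevel_iff_smoothToUniformizing`). In particular the line `birth` isolates no proper
sub-problem of the crux: its open stub is the crux in Néron-measure clothing (the lead's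
`promote-stub` certificate), and conversely any proof of the crux may freely aim at flatness of
`O ⊗_B Ω[B⁄k]` (a finitely presented module over a valuation ring: every elementary divisor of
the Jacobian presentation a unit) instead of regularity.

No new definitions; the two matrices are spelled out exactly as registered.
-/

noncomputable section

-- single-problem summit: the doubled namespace component `ResolutionOfSingularities` is forced
set_option linter.dupNamespace false

open Summit.ResolutionOfSingularities.ResolutionOfSingularities.Theses.IndSmooth (SmoothToUniformizing)

namespace Summit.ResolutionOfSingularities.ResolutionOfSingularities.Theorems.IndSmoothBirth

/-- **Pointwise: a flat level above `R` exists iff a model regular at the centre above `R`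
exists** (`k` perfect, `O` a valuation subring of `K ⊇ k`, `R ⊆ O`). ⇒: the flat level itself is
regular at the centre (`stub_valuativeJacobian`). ⇐: the regular model, with its inclusion into
`O` as structure map, is a flat level (`stub_flatOfRegularCentre`). [folklore] -/
theorem hasFlatLevel_iff_hasModel (k K : Type) [Field k] [PerfectField k] [Field K] [Algebra k K]
    (hK : (⊤ : IntermediateField k K).FG) (O : ValuationSubring K) (R : Subalgebra k K) :
    (∃ (B : Subalgebra k K) (_ : B.toSubring ≤ O.toSubring) (_ : Algebra B O)
        (_ : IsScalarTower B O K),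
        R ≤ B ∧ B.FG ∧ IsFractionRing B K ∧
          Module.Flat O (TensorProduct B O (KaehlerDifferential k B))) ↔
    (∃ (A : Subalgebra k K) (h : A.toSubring ≤ O.toSubring), R ≤ A ∧ A.FG ∧ IsFractionRing A K ∧
        IsRegularLocalRing (Localization.AtPrime
          (Ideal.comap (Subring.inclusion h) (IsLocalRing.maximalIdeal O)))) := by
  constructor
  · rintro ⟨B, h, _instA, _instT, hRB, hB, hfr, hflat⟩
    exact ⟨B, h, hRB, hB, hfr, stub_valuativeJacobian k K hK O B h hB hfr hflat⟩
  · rintro ⟨A, h, hRA, hA, hfr, hreg⟩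
    letI : Algebra A O :=
      ((A.val.toRingHom).codRestrict O.toSubring
        (fun a => h (Subalgebra.mem_toSubring.mpr a.2))).toAlgebra
    haveI : IsScalarTower A O K := IsScalarTower.of_algebraMap_eq (R := A) (S := O) (A := K)
      fun _ => rfl
    exact ⟨A, h, inferInstance, inferInstance, hRA, hA, hfr,
      stub_flatOfRegularCentre k K O A h hA hreg⟩

/-- **Certificate (registered sub-goal `stub_flatLevelAt_iff_lurelAt`): at every `p`, FLAT LEVELS
EXIST iff RELATIVE LOCAL UNIFORMIZATION HOLDS** — the conclusion of the line's load-bearing stub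
`stub_flatKaehlerLevel` (spelled out as registered) is equivalent to the conclusion of the crux
`SmoothToUniformizing` at `p` (= the route's target `LurelPerfect` at `p`). Pointwise transfer of
`hasFlatLevel_iff_hasModel`. [folklore] -/
theorem stub_flatLevelAt_iff_lurelAt (p : ℕ) :
    (∀ (k K : Type) [Field k] [CharP k p] [PerfectField k] [Field K] [Algebra k K],
      (⊤ : IntermediateField k K).FG → ∀ O : ValuationSubring K, (∀ c : k, algebraMap k K c ∈ O) →
      ∀ R : Subalgebra k K, R.FG → R.toSubring ≤ O.toSubring →
      ∃ (B : Subalgebra k K) (_ : B.toSubring ≤ O.toSubring) (_ : Algebra B O)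
        (_ : IsScalarTower B O K),
        R ≤ B ∧ B.FG ∧ IsFractionRing B K ∧
          Module.Flat O (TensorProduct B O (KaehlerDifferential k B))) ↔
    (∀ (k K : Type) [Field k] [CharP k p] [PerfectField k] [Field K] [Algebra k K],
      (⊤ : IntermediateField k K).FG → ∀ O : ValuationSubring K, (∀ c : k, algebraMap k K c ∈ O) →
      ∀ R : Subalgebra k K, R.FG → R.toSubring ≤ O.toSubring →
      ∃ (A : Subalgebra k K) (h : A.toSubring ≤ O.toSubring), R ≤ A ∧ A.FG ∧ IsFractionRing A K ∧
        IsRegularLocalRing (Localization.AtPrime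
          (Ideal.comap (Subring.inclusion h) (IsLocalRing.maximalIdeal O)))) := by
  constructor
  · intro H k K _ _ _ _ _ hK O hO R hR hRO
    exact (hasFlatLevel_iff_hasModel k K hK O R).mp (H k K hK O hO R hR hRO)
  · intro H k K _ _ _ _ _ hK O hO R hR hRO
    exact (hasFlatLevel_iff_hasModel k K hK O R).mpr (H k K hK O hO R hR hRO)

/-- **The load-bearing stub of line `birth` is the crux.** The statement of the registered stub
`stub_flatKaehlerLevel` (ind-smooth at `p` ⇒ a flat level at `p`), universally quantified over
primes `p`, is EQUIVALENT to `IndSmooth.SmoothToUniformizing`. So the line isolates no proper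
sub-problem: proving its open stub is proving the crux (in Néron-measure form), and refuting it
would refute the crux — hence, by the disprover's `Disproof.lean` §1, resolution of
singularities in positive characteristic. [folklore] -/
theorem flatKaehlerLevel_iff_smoothToUniformizing :
    (∀ p : ℕ, p.Prime →
      (∀ (k K : Type) [Field k] [CharP k p] [PerfectField k] [Field K] [Algebra k K],
        (⊤ : IntermediateField k K).FG → ∀ O : ValuationSubring K, (∀ c : k, algebraMap k K c ∈ O) →
        ∀ R : Subalgebra k K, R.FG → R.toSubring ≤ O.toSubring →
        ∃ (T : Type) (_ : CommRing T) (_ : Algebra k T), Algebra.Smooth k T ∧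
          ∃ (ψ : R →ₐ[k] T) (χ : T →ₐ[k] K), (∀ t : T, χ t ∈ O) ∧ ∀ r : R, χ (ψ r) = (r : K)) →
      ∀ (k K : Type) [Field k] [CharP k p] [PerfectField k] [Field K] [Algebra k K],
        (⊤ : IntermediateField k K).FG → ∀ O : ValuationSubring K, (∀ c : k, algebraMap k K c ∈ O) →
        ∀ R : Subalgebra k K, R.FG → R.toSubring ≤ O.toSubring →
        ∃ (B : Subalgebra k K) (_ : B.toSubring ≤ O.toSubring) (_ : Algebra B O)
          (_ : IsScalarTower B O K),
          R ≤ B ∧ B.FG ∧ IsFractionRing B K ∧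
            Module.Flat O (TensorProduct B O (KaehlerDifferential k B))) ↔
    SmoothToUniformizing := by
  constructor
  · intro H p hp hV
    exact (stub_flatLevelAt_iff_lurelAt p).mp (H p hp hV)
  · intro H p hp hV
    exact (stub_flatLevelAt_iff_lurelAt p).mpr (H p hp hV)

end Summit.ResolutionOfSingularities.ResolutionOfSingularities.Theorems.IndSmoothBirth

end
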